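import Literature.Topology.FourManifolds.HomotopySpheresSignature
import Literature.Topology.FourManifolds.NullCobordismBoundaryHomology
import Literature.Topology.FourManifolds.RelFundamentalClassOfOrientation
import Literature.Topology.FourManifolds.IntersectionLatticeOrientationIffProofs
import Literature.Topology.FourManifolds.SmoothHomologicalOrientationProofs
import Literature.Topology.FourManifolds.InteriorConnected
import Literature.Topology.FourManifolds.BordismFourOrientation
import Literature.AlgebraicTopology.SingularHomology.BoundaryClassGenerator
import Literature.AlgebraicTopology.SingularHomology.FundamentalClassProofs
import Literature.AlgebraicTopology.SingularHomology.FundamentalClassExistence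
import HarnessLib

/-!
# The closed model `W ∪ cone(∂W)` of an oriented manifold with boundary is oriented, and
# `(∂W, ∂[W, ∂W]) = bW` as oriented manifolds

Topic `Literature/Topology/FourManifolds`. The tree's notion "`(M, μ) = bW` as oriented
manifolds" (`Literature.Topology.FourManifolds.IsOrientedBoundary`, `BoundarySignature.lean`;
`NullCobordism.IsOrientedBy`, `HomotopySpheresSignature.lean`) asks, for a homological
orientation `μ` of `M ≅ ∂W` and a homological orientation `μ'` of the **closed model**
`Ŵ = W ∪ cone(∂W) = W/∂W` (`Literature.Topology.FourManifolds.ClosedModel`, the one-point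
compactification of the interior), for a relative class `w ∈ Hₙ₊₁(W, ∂W; ℤ)` with `∂w = [M]_μ`
and `q_* w = j_* [Ŵ]_{μ'}` (`q : (W, ∂W) → (Ŵ, ∞)` the collapse). It enters every element of
Kervaire–Milnor's sets of signatures `σ(M)` (`HomotopySphere.signatureSet`) and so far the tree
had no way to **produce** such a pair `(μ, μ')`. This file proves that an orientation of `W` — a
relative fundamental class `z = [W, ∂W]` in Spanier's sense
(`Literature.AlgebraicTopology.SingularHomology.IsRelFundamentalClass`), which a smooth
orientation of `W` provides (`NullCobordism.exists_isRelFundamentalClass_of_smoothOrientation`,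
`RelFundamentalClassOfOrientation.lean`) — produces one, whenever the closed model is a connected
topological manifold (the case of interest: `∂W` a homotopy sphere of dimension `≥ 5`, for which
`Ŵ` is a manifold by `HomotopySphere.nonempty_chartedSpace_closedModel`, Kosinski X, proof of
(3.3) with VIII.4.6).

Printed sources. A. Hatcher, *Algebraic Topology* (2002), §3.3, p. 253: "an orientation of `M`
determines an orientation of `∂M`", `∂[M, ∂M] = [∂M]`; Prop. 2.22 (`H(W, ∂W) ≅ H(W/∂W, ∂W/∂W)`
for the collared `∂W`); Thm. 3.26 and Lemma 3.27 (fundamental classes of closed manifolds).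
E. Spanier, *Algebraic Topology* (1981), Ch. 6 §3, Cor. 10 (`∂z` is a fundamental class of the
boundary; proved in the tree, `BoundaryClassGenerator.lean`). M. Kervaire, J. Milnor, *Groups of
homotopy spheres I*, Ann. of Math. 77 (1963), §7, footnote pp. 528–529: "adjoin a cone over the
boundary, thus obtaining a closed homology manifold with the same signature".

## The argument (all proved; no named facts)

Let `n ≠ 0`, `W` a compact Hausdorff `C¹` `(n+1)`-manifold with boundary, `z ∈ Hₙ₊₁(W, ∂W; ℤ)`.

* `exists_ofAbsolute_eq_map_boundaryCollapse`: `q_* z = j_* ẑ` for some `ẑ ∈ Hₙ₊₁(Ŵ; ℤ)`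
  (exact sequence of `(Ŵ, ∞)`, `Hₙ(∞) = 0`); a choice `liftClass hn z = ẑ`.
* `isIso_map_boundaryCollapse_of_mem_interior`, `map_toLocal_eq_toLocal_of_ofAbsolute_eq`,
  `isGenerator_toLocal_of_ofAbsolute_eq`: at an interior point `x`, `q_* : Hₖ(W | x) ≅ Hₖ(Ŵ | q x)`
  (local homology is local; `q` is an open embedding on the interior) carries `z|ₓ` to `ẑ|_{q x}`,
  so `ẑ|_{q x}` is a generator when `z` is a relative fundamental class.
* `connectedSpace_closedModel`: `Ŵ` is connected for `W` connected with `∂W ≠ ∅` (one-point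
  compactification of the connected non-compact interior; Bröcker–Jänich (13.3)–(13.4),
  `isPreconnected_interior`).
* `toLocal_liftClass_ne_zero`, `closedModelOrientation`: on the connected manifold `Ŵ` the class
  `ẑ` vanishes nowhere (continuation of zeros, Hatcher p. 236), hence defines the `ℤ`-orientation
  `HomologicalOrientation.ofClass … ẑ` (`FundamentalClassProofs.lean`).
* `closedModelOrientation_fundamentalClass`, `isFundamentalClass_closedModelOrientation`:
  `[Ŵ] = ẑ` — the fundamental class of this orientation (Hatcher Thm. 3.26(a), tree theorem
  `isFundamentalClass_fundamentalClass_holds`) agrees with `ẑ` at an interior point, hence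
  everywhere (Thm. 3.26(b), `toLocal_injective_of_connectedSpace_holds`).
* `isOrientedBoundary_boundaryOrientation_closedModelOrientation`: with
  `μ = (boundaryOrientation ℤ hn hz).comap e` (`∂z` transported along `e : M ≃ₜ ∂W`) and
  `μ' = closedModelOrientation hn hz`, `IsOrientedBoundary n f hf μ μ'` holds with `w = z`.
* `NullCobordism.exists_isOrientedBy_of_isRelFundamentalClass`,
  `NullCobordism.exists_isOrientedBy_of_smoothOrientation`: a smoothly oriented (e.g.
  parallelizable, `IsParallelizable.isOrientable`) connected `W` with `bW = M` closed nonempty,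
  whose closed model is a topological manifold, is oriented-bounded by `M`:
  `∃ μ μ', c.IsOrientedBy μ μ'`.
* `NullCobordism.exists_isCompatible_isOrientedBy_of_smoothOrientation`: the remaining clause of
  `HomotopySphere.signatureSet` (`HomotopySpheresSignature.lean`) — compatibility
  `SmoothOrientation.IsCompatible g S.orientation μ` of the boundary orientation `μ` with the
  GIVEN smooth orientation of the boundary, for the generator convention `g` — is met for `M`
  connected by flipping the orientation of `W` when necessary (Kervaire–Milnor's `-M`): the
  orientation `μ` produced is `±` the one compatible with `S.orientation` (Bredon VI.7.15, tree
  theorem `SmoothOrientation.existsUnique_isCompatible_holds`; Hatcher p. 234,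
  `HomologicalOrientation.eq_or_eq_neg_of_connected_holds`), and in the second case `(-μ, -μ')`
  still satisfies `c.IsOrientedBy` (`IsOrientedBoundary.neg` with Hatcher's
  `[X]_{-μ} = -[X]_μ`, `HomologicalOrientation.fundamentalClass_neg_holds`). So for a connected
  boundary with a given smooth orientation `o`, `∃ μ μ', IsCompatible g o μ ∧ c.IsOrientedBy μ μ'`
  follows from a smooth orientation of `c.W`; what an element of `signatureSet g m h ⟨M, o, _⟩`
  needs beyond this is `IsStablyParallelizable c.W` and the value of the signature. (The weaker
  companion `SmoothOrientation.exists_isCompatible` chooses the smooth orientation instead.)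

## References

* A. Hatcher, *Algebraic Topology*, CUP 2002, Prop. 2.22, §3.3 pp. 233–236 (Thm. 3.26,
  Lemma 3.27), pp. 252–254. [Hatcher2002]
* E. H. Spanier, *Algebraic Topology*, Springer 1981, Ch. 6 §3, definition of fundamental class
  and Cor. 10. [Spanier1981]
* M. Kervaire, J. Milnor, *Groups of homotopy spheres I*, Ann. of Math. 77 (1963), §2 ("`-M`"),
  §7 ("`Σ = bM`", footnote pp. 528–529). [KervaireMilnorAnnals1963]
* T. Bröcker, K. Jänich, *Introduction to Differential Topology*, CUP 1982, (13.3)–(13.4).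
  [BrockerJanich1982]
-/

open scoped Manifold ContDiff Topology
open Set Function CategoryTheory CategoryTheory.Limits Topology

noncomputable section

universe u

namespace Literature.Topology.FourManifolds

open Literature.AlgebraicTopology.SingularHomology

section General

variable {n : ℕ} {W : Type u} [TopologicalSpace W] [T2Space W] [CompactSpace W]
  [ChartedSpace (EuclideanHalfSpace (n + 1)) W] [IsManifold (𝓡∂ (n + 1)) 1 W]

/-! ### The lift of `q_* z` to `Hₙ₊₁(Ŵ; ℤ)` -/

/-- **`q_* z` lifts to absolute homology.** For `n ≠ 0` and any relative class
`z ∈ Hₙ₊₁(W, ∂W; ℤ)`, its image `q_* z ∈ Hₙ₊₁(Ŵ, ∞; ℤ)` under the collapse `q : (W, ∂W) → (Ŵ, ∞)`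
is `j_* ẑ` for some `ẑ ∈ Hₙ₊₁(Ŵ; ℤ)`: the next term `Hₙ(∞; ℤ)` of the exact sequence of the pair
`(Ŵ, ∞)` vanishes (Hatcher 2002, Thm. 2.13 and Prop. 2.8). [cite: Hatcher2002, Thm. 2.13 and Prop. 2.8] -/
theorem exists_ofAbsolute_eq_map_boundaryCollapse (hn : n ≠ 0)
    (z : relativeSingularHomology ℤ ℤ W ((𝓡∂ (n + 1)).boundary W) (n + 1)) :
    ∃ zhat : singularHomology ℤ ℤ (ClosedModel n W) (n + 1),
      relativeSingularHomology.ofAbsolute ℤ ℤ (ClosedModel n W) {ClosedModel.infty} (n + 1) zhat =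
        relativeSingularHomology.map ℤ ℤ (boundaryCollapse n W) (mapsTo_boundaryCollapse n W)
          (n + 1) z := by
  haveI : Subsingleton (singularHomology ℤ ℤ
      ↥({ClosedModel.infty} : Set (ClosedModel n W)) n) :=
    ModuleCat.subsingleton_of_isZero (isZero_singularHomology_of_subsingleton ℤ ℤ hn)
  have hex := relativeSingularHomology.exact_ofAbsolute_δ ℤ ℤ
    ({ClosedModel.infty} : Set (ClosedModel n W)) n
  rw [ShortComplex.moduleCat_exact_iff] at hex
  exact hex _ (Subsingleton.elim _ _)

/-! ### Local images at interior points -/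

/-- The collapse `q : W → Ŵ` is injective over interior points: it maps `W ∖ {x}` into
`Ŵ ∖ {q x}` for `x` interior. [folklore] -/
theorem mapsTo_boundaryCollapse_compl_singleton {x : W} (hx : x ∈ (𝓡∂ (n + 1)).interior W) :
    MapsTo (boundaryCollapse n W) ({x}ᶜ : Set W) ({boundaryCollapse n W x}ᶜ : Set (ClosedModel n W)) := by
  intro y hy h
  rw [mem_compl_iff, mem_singleton_iff] at hy
  rw [boundaryCollapse_of_mem_interior hx] at h
  by_cases hy' : y ∈ (𝓡∂ (n + 1)).interior W
  · rw [boundaryCollapse_of_mem_interior hy'] at h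
    exact hy (congrArg Subtype.val (OnePoint.coe_injective h))
  · rw [boundaryCollapse_apply, boundaryCollapseFun_of_not_mem hy'] at h
    exact (OnePoint.infty_ne_coe _ h).elim

/-- The inclusion of the interior `W ∖ ∂W ↪ W` as a continuous map. [folklore] -/
abbrev interiorIncl (n : ℕ) (W : Type u) [TopologicalSpace W]
    [ChartedSpace (EuclideanHalfSpace (n + 1)) W] : C(ManifoldInterior n W, W) :=
  ⟨Subtype.val, continuous_subtype_val⟩

/-- The inclusion of the interior into the closed model `Ŵ`, as a continuous map. [folklore] -/
abbrev interiorToClosedModel (n : ℕ) (W : Type u) [TopologicalSpace W]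
    [ChartedSpace (EuclideanHalfSpace (n + 1)) W] : C(ManifoldInterior n W, ClosedModel n W) :=
  ⟨ClosedModel.ofInterior, OnePoint.continuous_coe⟩

/-- On the interior the collapse is the inclusion into `Ŵ`: `q ∘ ι = coe`. [folklore] -/
theorem boundaryCollapse_comp_interiorIncl :
    (boundaryCollapse n W).comp (interiorIncl n W) = interiorToClosedModel n W := by
  ext x
  exact boundaryCollapse_of_mem_interior x.2

/-- **The collapse induces isomorphisms of local homology at interior points**:
`q_* : Hₖ(W | x) ≅ Hₖ(Ŵ | q x)` for `x ∈ W ∖ ∂W`, since `q` restricted to the open interior is an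
open embedding and local homology depends only on a neighbourhood (Hatcher 2002, §3.3, p. 231).
[cite: Hatcher2002, §3.3 p. 231] -/
theorem isIso_map_boundaryCollapse_of_mem_interior {x : W} (hx : x ∈ (𝓡∂ (n + 1)).interior W)
    (k : ℕ) :
    IsIso (relativeSingularHomology.map ℤ ℤ (boundaryCollapse n W)
      (mapsTo_boundaryCollapse_compl_singleton hx) k) := by
  -- the two open embeddings `ι : W° → W` and `coe : W° → Ŵ`
  have hι : IsOpenEmbedding (interiorIncl n W) :=
    ((𝓡∂ (n + 1)).isOpen_interior (M := W) one_ne_zero).isOpenEmbedding_subtypeVal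
  have hc : IsOpenEmbedding (interiorToClosedModel n W) := OnePoint.isOpenEmbedding_coe
  have h₁ : MapsTo (interiorIncl n W) ({(⟨x, hx⟩ : ManifoldInterior n W)}ᶜ : Set _)
      ({x}ᶜ : Set W) := fun y hy h => hy (Subtype.ext h)
  have h₂ : MapsTo (interiorToClosedModel n W) ({(⟨x, hx⟩ : ManifoldInterior n W)}ᶜ : Set _)
      ({boundaryCollapse n W x}ᶜ : Set (ClosedModel n W)) := by
    intro y hy h
    rw [boundaryCollapse_of_mem_interior hx] at h
    exact hy (OnePoint.coe_injective h)
  haveI i₁ : IsIso (relativeSingularHomology.map ℤ ℤ (interiorIncl n W) h₁ k) :=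
    localHomology.isIso_map_of_isOpenEmbedding ℤ ℤ (interiorIncl n W) hι ⟨x, hx⟩ h₁ k
  haveI i₂ : IsIso (relativeSingularHomology.map ℤ ℤ (interiorToClosedModel n W) h₂ k) := by
    have key : ∀ (p : ClosedModel n W), p = interiorToClosedModel n W ⟨x, hx⟩ →
        ∀ h₂' : MapsTo (interiorToClosedModel n W) ({(⟨x, hx⟩ : ManifoldInterior n W)}ᶜ : Set _)
          ({p}ᶜ : Set (ClosedModel n W)),
        IsIso (relativeSingularHomology.map ℤ ℤ (interiorToClosedModel n W) h₂' k) := by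
      rintro p rfl h₂'
      exact localHomology.isIso_map_of_isOpenEmbedding ℤ ℤ (interiorToClosedModel n W) hc ⟨x, hx⟩
        h₂' k
    exact key _ (boundaryCollapse_of_mem_interior hx) h₂
  have hfac : relativeSingularHomology.map ℤ ℤ (interiorIncl n W) h₁ k ≫
      relativeSingularHomology.map ℤ ℤ (boundaryCollapse n W)
        (mapsTo_boundaryCollapse_compl_singleton hx) k =
      relativeSingularHomology.map ℤ ℤ (interiorToClosedModel n W) h₂ k := by
    rw [← relativeSingularHomology.map_comp]
    congr 1
    exact boundaryCollapse_comp_interiorIncl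
  exact IsIso.of_isIso_fac_left hfac

/-- **The local image of the lift at an interior point is `q_*` of the local image of `z`.**
If `j_* ẑ = q_* z`, then for `x ∈ W ∖ ∂W` the image of `ẑ` in `Hₙ₊₁(Ŵ | q x)` is the image under
`q_* : Hₙ₊₁(W | x) → Hₙ₊₁(Ŵ | q x)` of the image of `z` in `Hₙ₊₁(W | x)` (both are `q_* z` for the
map of pairs `q : (W, ∂W) → (Ŵ, Ŵ ∖ q x)`; naturality, Hatcher 2002, §2.1). [cite: Hatcher2002, §2.1 (naturality)] -/
theorem map_toLocal_eq_toLocal_of_ofAbsolute_eq {x : W} (hx : x ∈ (𝓡∂ (n + 1)).interior W)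
    {z : relativeSingularHomology ℤ ℤ W ((𝓡∂ (n + 1)).boundary W) (n + 1)}
    {zhat : singularHomology ℤ ℤ (ClosedModel n W) (n + 1)}
    (h : relativeSingularHomology.ofAbsolute ℤ ℤ (ClosedModel n W) {ClosedModel.infty} (n + 1) zhat =
      relativeSingularHomology.map ℤ ℤ (boundaryCollapse n W) (mapsTo_boundaryCollapse n W)
        (n + 1) z) :
    relativeSingularHomology.map ℤ ℤ (boundaryCollapse n W)
        (mapsTo_boundaryCollapse_compl_singleton hx) (n + 1)
        (relativeSingularHomology.toLocal ℤ ℤ ((𝓡∂ (n + 1)).boundary W)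
          ⟨x, by rwa [ModelWithCorners.compl_boundary]⟩ (n + 1) z) =
      singularHomology.toLocal ℤ ℤ (boundaryCollapse n W x) (n + 1) zhat := by
  have hqx := boundaryCollapse_of_mem_interior hx
  -- `q` as a map of pairs `(W, ∂W) → (Ŵ, Ŵ ∖ q x)`
  have hq : MapsTo (boundaryCollapse n W) ((𝓡∂ (n + 1)).boundary W)
      ({boundaryCollapse n W x}ᶜ : Set (ClosedModel n W)) := by
    intro y hy h'
    rw [mem_singleton_iff, boundaryCollapse_of_mem_boundary hy, hqx] at h'
    exact OnePoint.infty_ne_coe _ h'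
  have hid : MapsTo (ContinuousMap.id (ClosedModel n W)) ({ClosedModel.infty} : Set (ClosedModel n W))
      ({boundaryCollapse n W x}ᶜ : Set (ClosedModel n W)) := by
    intro p hp h'
    rw [mem_singleton_iff] at hp
    rw [hp, mem_singleton_iff, hqx] at h'
    exact OnePoint.infty_ne_coe _ h'
  -- left-hand side
  have lhs : relativeSingularHomology.map ℤ ℤ (boundaryCollapse n W)
        (mapsTo_boundaryCollapse_compl_singleton hx) (n + 1)
        (relativeSingularHomology.toLocal ℤ ℤ ((𝓡∂ (n + 1)).boundary W)
          ⟨x, by rwa [ModelWithCorners.compl_boundary]⟩ (n + 1) z) =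
      relativeSingularHomology.map ℤ ℤ (boundaryCollapse n W) hq (n + 1) z := by
    rw [relativeSingularHomology.toLocal, ← ModuleCat.comp_apply,
      ← relativeSingularHomology.map_comp]
    rfl
  -- right-hand side
  have rhs : singularHomology.toLocal ℤ ℤ (boundaryCollapse n W x) (n + 1) zhat =
      relativeSingularHomology.map ℤ ℤ (boundaryCollapse n W) hq (n + 1) z := by
    have e₁ : singularHomology.toLocal ℤ ℤ (boundaryCollapse n W x) (n + 1) =
        relativeSingularHomology.ofAbsolute ℤ ℤ (ClosedModel n W) {ClosedModel.infty} (n + 1) ≫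
          relativeSingularHomology.map ℤ ℤ (ContinuousMap.id (ClosedModel n W)) hid (n + 1) := by
      rw [relativeSingularHomology.ofAbsolute_comp_map, singularHomology.map_id,
        Category.id_comp]
      rfl
    rw [e₁, ModuleCat.comp_apply, h, ← ModuleCat.comp_apply, ← relativeSingularHomology.map_comp]
    rfl
  rw [lhs, rhs]

/-- **At interior points the lift restricts to generators**: if `z` is a relative fundamental
class of `(W, ∂W)` and `j_* ẑ = q_* z`, then `ẑ|_{q x}` generates `Hₙ₊₁(Ŵ | q x; ℤ)` for every
`x ∈ W ∖ ∂W` (Spanier's definition of a fundamental class, transported along the isomorphism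
`q_* : Hₙ₊₁(W | x) ≅ Hₙ₊₁(Ŵ | q x)`). [cite: Spanier1981, Ch. 6 Sec. 3 (definition of fundamental class)] -/
theorem isGenerator_toLocal_of_ofAbsolute_eq
    {z : relativeSingularHomology ℤ ℤ W ((𝓡∂ (n + 1)).boundary W) (n + 1)}
    (hz : IsRelFundamentalClass ℤ ((𝓡∂ (n + 1)).boundary W) z)
    {zhat : singularHomology ℤ ℤ (ClosedModel n W) (n + 1)}
    (h : relativeSingularHomology.ofAbsolute ℤ ℤ (ClosedModel n W) {ClosedModel.infty} (n + 1) zhat =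
      relativeSingularHomology.map ℤ ℤ (boundaryCollapse n W) (mapsTo_boundaryCollapse n W)
        (n + 1) z)
    {x : W} (hx : x ∈ (𝓡∂ (n + 1)).interior W) :
    ∃ e : localHomology ℤ ℤ (ClosedModel n W) (boundaryCollapse n W x) (n + 1) ≃ₗ[ℤ] ℤ,
      e (singularHomology.toLocal ℤ ℤ (boundaryCollapse n W x) (n + 1) zhat) = 1 := by
  rw [← map_toLocal_eq_toLocal_of_ofAbsolute_eq hx h]
  haveI := isIso_map_boundaryCollapse_of_mem_interior hx (n + 1)
  exact (exists_linearEquiv_apply_eq_one_iff_of_isIso _ _).2 (hz ⟨x, _⟩)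

/-! ### The closed model is connected -/

omit [CompactSpace W] in
/-- The interior of a manifold with nonempty boundary is not compact (it is dense and not the
whole space, but compact subsets of the Hausdorff `W` are closed). [folklore] -/
theorem noncompactSpace_manifoldInterior (hW : ((𝓡∂ (n + 1)).boundary W).Nonempty) :
    NoncompactSpace (ManifoldInterior n W) := by
  refine ⟨fun hc => ?_⟩
  have hK : IsCompact ((𝓡∂ (n + 1)).interior W) := by
    haveI : CompactSpace (ManifoldInterior n W) := isCompact_univ_iff.1 hc
    exact isCompact_iff_compactSpace.2 (inferInstanceAs (CompactSpace (ManifoldInterior n W)))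
  have huniv : (𝓡∂ (n + 1)).interior W = univ := by
    rw [← hK.isClosed.closure_eq]
    exact (dense_interior (I := 𝓡∂ (n + 1)) (M := W)).closure_eq
  obtain ⟨x, hx⟩ := hW
  have hx' : x ∈ ((𝓡∂ (n + 1)).boundary W)ᶜ := by
    rw [ModelWithCorners.compl_boundary, huniv]
    exact mem_univ x
  exact hx' hx

omit [T2Space W] [CompactSpace W] in
/-- The interior of a preconnected `C¹` manifold with boundary is preconnected
(`isPreconnected_interior`, Bröcker–Jänich (13.3)–(13.4)). [folklore] -/
theorem preconnectedSpace_manifoldInterior [PreconnectedSpace W] :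
    PreconnectedSpace (ManifoldInterior n W) :=
  isPreconnected_iff_preconnectedSpace.1 (isPreconnected_interior (I := 𝓡∂ (n + 1)) (M := W))

omit [CompactSpace W] in
/-- **The closed model `W ∪ cone(∂W)` of a connected manifold with nonempty boundary is
connected** (the one-point compactification of the connected, non-compact interior). [folklore] -/
theorem connectedSpace_closedModel [PreconnectedSpace W]
    (hW : ((𝓡∂ (n + 1)).boundary W).Nonempty) : ConnectedSpace (ClosedModel n W) := by
  haveI := noncompactSpace_manifoldInterior hW
  haveI := preconnectedSpace_manifoldInterior (n := n) (W := W)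
  exact inferInstanceAs (ConnectedSpace (OnePoint (ManifoldInterior n W)))

/-! ### The orientation of the closed model -/

/-- **The lift `ẑ ∈ Hₙ₊₁(Ŵ; ℤ)` of `q_* z`** (a choice; `exists_ofAbsolute_eq_map_boundaryCollapse`).
For `z = [W, ∂W]` a relative fundamental class this is the fundamental class `[Ŵ]` of the closed
model (`isFundamentalClass_closedModelOrientation`; Kervaire–Milnor 1963, footnote pp. 528–529:
"attach a cone over the boundary, thus obtaining a closed homology manifold"; Hatcher 2002,
Prop. 2.22: `Hₙ₊₁(W, ∂W) ≅ Hₙ₊₁(W/∂W, ∂W/∂W)`). [cite: KervaireMilnorAnnals1963, §7, footnote pp. 528–529] -/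
def liftClass (hn : n ≠ 0)
    (z : relativeSingularHomology ℤ ℤ W ((𝓡∂ (n + 1)).boundary W) (n + 1)) :
    singularHomology ℤ ℤ (ClosedModel n W) (n + 1) :=
  (exists_ofAbsolute_eq_map_boundaryCollapse hn z).choose

/-- `j_* ẑ = q_* z` in `Hₙ₊₁(Ŵ, ∞; ℤ)`. [folklore] -/
theorem ofAbsolute_liftClass (hn : n ≠ 0)
    (z : relativeSingularHomology ℤ ℤ W ((𝓡∂ (n + 1)).boundary W) (n + 1)) :
    relativeSingularHomology.ofAbsolute ℤ ℤ (ClosedModel n W) {ClosedModel.infty} (n + 1)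
        (liftClass hn z) =
      relativeSingularHomology.map ℤ ℤ (boundaryCollapse n W) (mapsTo_boundaryCollapse n W)
        (n + 1) z :=
  (exists_ofAbsolute_eq_map_boundaryCollapse hn z).choose_spec

variable [ChartedSpace (EuclideanSpace ℝ (Fin (n + 1))) (ClosedModel n W)]

/-- **The lift of a relative fundamental class vanishes nowhere on `Ŵ`** when `Ŵ` is a connected
topological manifold: it restricts to a generator at the interior points (which exist), and
zeros propagate along the connected `Ŵ` (Hatcher 2002, §3.3, p. 236, proof of Thm. 3.26).
[cite: Hatcher2002, §3.3 p. 236 (proof of Thm. 3.26)] -/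
theorem toLocal_liftClass_ne_zero [PreconnectedSpace (ClosedModel n W)] [Nonempty W] (hn : n ≠ 0)
    {z : relativeSingularHomology ℤ ℤ W ((𝓡∂ (n + 1)).boundary W) (n + 1)}
    (hz : IsRelFundamentalClass ℤ ((𝓡∂ (n + 1)).boundary W) z) (y : ClosedModel n W) :
    singularHomology.toLocal ℤ ℤ y (n + 1) (liftClass hn z) ≠ 0 := by
  intro hy
  obtain ⟨x, hx⟩ := interior_nonempty (I := 𝓡∂ (n + 1)) (M := W)
  obtain ⟨e, he⟩ := isGenerator_toLocal_of_ofAbsolute_eq hz (ofAbsolute_liftClass hn z) hx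
  rw [singularHomology.toLocal_eq_zero_of_toLocal_eq_zero ℤ ℤ (EuclideanSpace ℝ (Fin (n + 1)))
    (liftClass hn z) hy (boundaryCollapse n W x), map_zero] at he
  exact zero_ne_one he

/-- **The orientation of the closed model `Ŵ = W ∪ cone(∂W)` induced by a relative fundamental
class `z = [W, ∂W]`**, for `Ŵ` a connected topological `(n+1)`-manifold (e.g. `∂W` a homotopy
sphere of dimension `n ≥ 5`, `nonempty_chartedSpace_closedModel`): the `ℤ`-orientation defined by
the nowhere-vanishing class `ẑ` (`HomologicalOrientation.ofClass`, Hatcher 2002, §3.3, pp. 235–236),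
whose local classes are the generators of which the `ẑ|_y` are positive multiples — in fact
`ẑ|_y` itself (`isFundamentalClass_closedModelOrientation`). This is the orientation "of `W`" in
the sense of `Literature.Topology.FourManifolds.IsOrientedBoundary` (Kervaire–Milnor 1963, §7,
footnote pp. 528–529). [cite: Hatcher2002, §3.3 pp. 235–236] [cite: KervaireMilnorAnnals1963, §7, footnote pp. 528–529] -/
def closedModelOrientation [PreconnectedSpace (ClosedModel n W)] [Nonempty W] (hn : n ≠ 0)
    {z : relativeSingularHomology ℤ ℤ W ((𝓡∂ (n + 1)).boundary W) (n + 1)}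
    (hz : IsRelFundamentalClass ℤ ((𝓡∂ (n + 1)).boundary W) z) :
    HomologicalOrientation ℤ (ClosedModel n W) (n + 1) :=
  HomologicalOrientation.ofClass (fun y => (localHomology.nonempty_linearEquiv ℤ (n := n + 1) y).some)
    (liftClass hn z) (toLocal_liftClass_ne_zero hn hz)

/-- A generator is its own normalised generator: `genOf e a = a` if `a` corresponds to `1` under
some identification with `ℤ`. [folklore] -/
theorem Int.genOf_eq_self_of_exists {L : Type*} [AddCommGroup L] [Module ℤ L] (e : L ≃ₗ[ℤ] ℤ)
    {a : L} (h : ∃ e' : L ≃ₗ[ℤ] ℤ, e' a = 1) : Int.genOf e a = a := by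
  obtain ⟨e', he'⟩ := h
  rw [Int.genOf_eq e' e a, Int.genOf, he', Int.sign_one, ← he', LinearEquiv.symm_apply_apply]

/-- **At interior points the local class of the closed-model orientation is `ẑ|_{q x}`.**
[folklore] -/
theorem closedModelOrientation_localClass_boundaryCollapse [PreconnectedSpace (ClosedModel n W)]
    [Nonempty W] (hn : n ≠ 0)
    {z : relativeSingularHomology ℤ ℤ W ((𝓡∂ (n + 1)).boundary W) (n + 1)}
    (hz : IsRelFundamentalClass ℤ ((𝓡∂ (n + 1)).boundary W) z) {x : W}
    (hx : x ∈ (𝓡∂ (n + 1)).interior W) :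
    (closedModelOrientation hn hz).localClass (boundaryCollapse n W x) =
      singularHomology.toLocal ℤ ℤ (boundaryCollapse n W x) (n + 1) (liftClass hn z) := by
  rw [closedModelOrientation, HomologicalOrientation.ofClass_localClass]
  exact Int.genOf_eq_self_of_exists _
    (isGenerator_toLocal_of_ofAbsolute_eq hz (ofAbsolute_liftClass hn z) hx)

/-- **`ẑ` is the fundamental class of the closed-model orientation**: `[Ŵ] = ẑ` for `Ŵ` a closed
connected topological manifold. The fundamental class `[Ŵ]` exists (Hatcher Thm. 3.26(a),
`isFundamentalClass_fundamentalClass_holds`) and agrees with `ẑ` at an interior point `q x` (both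
restrict to `ẑ|_{q x}`), hence everywhere (`Hₙ₊₁(Ŵ) → Hₙ₊₁(Ŵ | q x)` is injective, Thm. 3.26(b),
`toLocal_injective_of_connectedSpace_holds`). [cite: Hatcher2002, §3.3 Thm. 3.26] -/
theorem closedModelOrientation_fundamentalClass [ConnectedSpace (ClosedModel n W)] [Nonempty W]
    (hn : n ≠ 0) {z : relativeSingularHomology ℤ ℤ W ((𝓡∂ (n + 1)).boundary W) (n + 1)}
    (hz : IsRelFundamentalClass ℤ ((𝓡∂ (n + 1)).boundary W) z) :
    (closedModelOrientation hn hz).fundamentalClass = liftClass hn z := by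
  have hc₀ : IsFundamentalClass (closedModelOrientation hn hz)
      (closedModelOrientation hn hz).fundamentalClass :=
    HomologicalOrientation.isFundamentalClass_fundamentalClass_holds (R := ℤ)
      (X := ClosedModel n W) (n + 1) (closedModelOrientation hn hz)
  obtain ⟨x, hx⟩ := interior_nonempty (I := 𝓡∂ (n + 1)) (M := W)
  apply singularHomology.toLocal_injective_of_connectedSpace_holds ℤ ℤ (ClosedModel n W) (n + 1)
    (boundaryCollapse n W x)
  rw [hc₀ (boundaryCollapse n W x), closedModelOrientation_localClass_boundaryCollapse hn hz hx]

/-- **`ẑ` is a fundamental class for the closed-model orientation** (`[Ŵ] = ẑ` and Hatcher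
Thm. 3.26(a)). [cite: Hatcher2002, §3.3 Thm. 3.26] -/
theorem isFundamentalClass_closedModelOrientation [ConnectedSpace (ClosedModel n W)] [Nonempty W]
    (hn : n ≠ 0) {z : relativeSingularHomology ℤ ℤ W ((𝓡∂ (n + 1)).boundary W) (n + 1)}
    (hz : IsRelFundamentalClass ℤ ((𝓡∂ (n + 1)).boundary W) z) :
    IsFundamentalClass (closedModelOrientation hn hz) (liftClass hn z) := by
  rw [← closedModelOrientation_fundamentalClass hn hz]
  exact HomologicalOrientation.isFundamentalClass_fundamentalClass_holds (R := ℤ)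
    (X := ClosedModel n W) (n + 1) (closedModelOrientation hn hz)

/-! ### `(∂W, ∂z) = bW` as oriented manifolds -/

/-- **The boundary of an oriented compact manifold with boundary is its oriented boundary**, in
the homological sense of `Literature.Topology.FourManifolds.IsOrientedBoundary`: for `W` a compact
connected `C¹` `(n+1)`-manifold with boundary (`n ≠ 0`) whose closed model `Ŵ` is a topological
manifold, `z = [W, ∂W]` a relative fundamental class, and `f : M → W` an identification of `M`
with `∂W` (a homeomorphism `e : M ≃ₜ ∂W` with `e x = f x`), the pair
`(μ, μ') = ((∂-orientation of ∂W transported to M), closed-model orientation)` satisfies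
`IsOrientedBoundary n f hf μ μ'` with relative class `w = z`: (i) `∂ z = f_* [M]_μ` since
`[∂W] = ∂ z` for the boundary orientation (Spanier Cor. 6.3.10, `boundaryOrientation`,
`BoundaryClassGenerator`) and `[M]_{μ} = e⁻¹_* [∂W]` (`fundamentalClass_comap_holds`); (ii)
`q_* z = j_* [Ŵ]` since `[Ŵ] = ẑ` (`closedModelOrientation_fundamentalClass`). Hatcher 2002, §3.3,
p. 253 (`∂[M, ∂M] = [∂M]`), Prop. 2.22; Kervaire–Milnor 1963, §7 ("`Σ = bM`"). [cite: Hatcher2002, §3.3 p. 253 and Prop. 2.22] [cite: Spanier1981, Ch. 6 Sec. 3 Cor. 10] [cite: KervaireMilnorAnnals1963, §7] -/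
theorem isOrientedBoundary_boundaryOrientation_closedModelOrientation
    [ConnectedSpace (ClosedModel n W)] [Nonempty W] (hn : n ≠ 0)
    {z : relativeSingularHomology ℤ ℤ W ((𝓡∂ (n + 1)).boundary W) (n + 1)}
    (hz : IsRelFundamentalClass ℤ ((𝓡∂ (n + 1)).boundary W) z)
    {M : Type u} [TopologicalSpace M] (f : C(M, W)) (hf : ∀ x, f x ∈ (𝓡∂ (n + 1)).boundary W)
    (e : M ≃ₜ ↥((𝓡∂ (n + 1)).boundary W)) (hef : ∀ x, (e x : W) = f x) :
    IsOrientedBoundary n f hf ((boundaryOrientation ℤ hn hz).comap e)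
      (closedModelOrientation hn hz) := by
  refine ⟨z, ?_, ?_⟩
  · letI := boundaryTopChartedSpace (n := n) (W := W)
    haveI : CompactSpace ↥((𝓡∂ (n + 1)).boundary W) :=
      isCompact_iff_compactSpace.1 isCompact_boundary
    rw [HomologicalOrientation.fundamentalClass_comap_holds ℤ (↥((𝓡∂ (n + 1)).boundary W)) M n
      (boundaryOrientation ℤ hn hz) e, boundaryOrientation_fundamentalClass_eq,
      singularHomology.mapIso_inv, ← ModuleCat.comp_apply, ← singularHomology.map_comp]
    have hcomp : (boundaryCorestrict n f hf).comp (e.symm : C(↥((𝓡∂ (n + 1)).boundary W), M)) =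
        ContinuousMap.id _ := by
      refine ContinuousMap.ext fun x => Subtype.ext ?_
      show f (e.symm x) = x
      rw [← hef, Homeomorph.apply_symm_apply]
    rw [hcomp, singularHomology.map_id, ModuleCat.id_apply]
  · rw [closedModelOrientation_fundamentalClass hn hz, ofAbsolute_liftClass]

end General

/-! ### Null-cobordisms: `(M, μ) = bW` for an oriented `W` -/

namespace NullCobordism

variable {n : ℕ} {M : Type} [TopologicalSpace M] [ChartedSpace (EuclideanSpace ℝ (Fin n)) M]

/-- **An oriented null-cobordism orients its boundary**: for a null-cobordism `c` of `M`
(`M = ∂W`, `W = c.W` compact connected smooth, `n ≠ 0`) whose closed model `W ∪ cone(∂W)` is a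
topological manifold, and a relative fundamental class `z = [W, ∂W] ∈ Hₙ₊₁(W, ∂W; ℤ)` (an
orientation of `W`), there are homological orientations `μ` of `M` and `μ'` of the closed model
with `(M, μ) = bW` as oriented manifolds, `c.IsOrientedBy μ μ'` (Kervaire–Milnor 1963, §7:
"`Σ = bM`"; Hatcher 2002, p. 253), namely the transported boundary orientation `∂z` and the
closed-model orientation of `z`, whose fundamental class `[Ŵ] = ẑ` lifts `q_* z`.
[cite: KervaireMilnorAnnals1963, §7 (Thm. 7.5: "Σ₁ and Σ₂ … bound s-parallelizable manifolds")] [cite: Hatcher2002, §3.3 p. 253] -/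
theorem exists_isOrientedBy_of_isRelFundamentalClass (hn : n ≠ 0) (c : NullCobordism n M)
    [ConnectedSpace c.W] [Nonempty M]
    [ChartedSpace (EuclideanSpace ℝ (Fin (n + 1))) (ClosedModel n c.W)]
    {z : relativeSingularHomology ℤ ℤ c.W ((𝓡∂ (n + 1)).boundary c.W) (n + 1)}
    (hz : IsRelFundamentalClass ℤ ((𝓡∂ (n + 1)).boundary c.W) z) :
    ∃ (μ : HomologicalOrientation ℤ M n)
      (μ' : HomologicalOrientation ℤ (ClosedModel n c.W) (n + 1)),
      c.IsOrientedBy μ μ' ∧ μ'.fundamentalClass = liftClass hn z := by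
  have hW : ((𝓡∂ (n + 1)).boundary c.W).Nonempty := by
    obtain ⟨x⟩ := ‹Nonempty M›
    exact ⟨c.incl x, c.incl_mem_boundary x⟩
  haveI := connectedSpace_closedModel (n := n) (W := c.W) hW
  exact ⟨(boundaryOrientation ℤ hn hz).comap c.bdryHomeomorph, closedModelOrientation hn hz,
    isOrientedBoundary_boundaryOrientation_closedModelOrientation hn hz c.inclMap
      c.incl_mem_boundary c.bdryHomeomorph (fun _ => rfl),
    closedModelOrientation_fundamentalClass hn hz⟩

/-- **A smoothly oriented null-cobordism orients its boundary.** For `M : Type` closed smooth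
nonempty of dimension `m + 1`, `c` a null-cobordism of `M` with `c.W` connected and smoothly
oriented (`o : SmoothOrientation (𝓡∂ (m + 2)) c.W`; e.g. `c.W` parallelizable, Lee Prop. 15.17,
`IsParallelizable.isOrientable`), whose closed model is a topological manifold, there are
homological orientations with `(M, μ) = bW`: `∃ μ μ', c.IsOrientedBy μ μ'`. The relative
fundamental class is `NullCobordism.exists_isRelFundamentalClass_of_smoothOrientation` (Hatcher
2002, p. 253 with Lemma 3.27; Bredon VI.7.15), the rest is
`exists_isOrientedBy_of_isRelFundamentalClass`. This is Kervaire–Milnor's standing convention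
(1963, p. 504: "all manifolds … are to be compact, oriented") made available for the oriented
boundary relation `Σ = bM` of their §7. [cite: KervaireMilnorAnnals1963, p. 504 and §7] [cite: Hatcher2002, §3.3 p. 253] -/
theorem exists_isOrientedBy_of_smoothOrientation {m : ℕ} {M : Type} [TopologicalSpace M]
    [ChartedSpace (EuclideanSpace ℝ (Fin (m + 1))) M] [IsManifold (𝓡 (m + 1)) ∞ M]
    [CompactSpace M] [Nonempty M] (c : NullCobordism (m + 1) M) [ConnectedSpace c.W]
    [ChartedSpace (EuclideanSpace ℝ (Fin (m + 1 + 1))) (ClosedModel (m + 1) c.W)]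
    (o : SmoothOrientation (𝓡∂ (m + 1 + 1)) c.W) :
    ∃ (μ : HomologicalOrientation ℤ M (m + 1))
      (μ' : HomologicalOrientation ℤ (ClosedModel (m + 1) c.W) (m + 1 + 1)), c.IsOrientedBy μ μ' := by
  obtain ⟨z, hz⟩ := c.exists_isRelFundamentalClass_of_smoothOrientation o
  obtain ⟨μ, μ', h, -⟩ := exists_isOrientedBy_of_isRelFundamentalClass (Nat.succ_ne_zero m) c hz
  exact ⟨μ, μ', h⟩

end NullCobordism

/-! ### Choosing the smooth orientation of the boundary for a generator convention -/

/-- **Every homological orientation of a connected smooth manifold is compatible with some smooth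
orientation**, for every generator convention `g` (Bredon, *Topology and Geometry* (1993), VI.7,
Thm. 7.15: smooth and homological orientations correspond bijectively, compatibly with
reversal). For `M : Type` Hausdorff, connected, `C¹`: `M` carries a smooth orientation `o₀`
(`nonempty_smoothOrientation_of_homologicalOrientation`, from `μ` itself), `o₀` has a compatible
homological orientation `μ₀` (`SmoothOrientation.existsUnique_isCompatible_holds`), and `μ = ±μ₀`
on the connected `M` (Hatcher 2002, p. 234, `HomologicalOrientation.eq_or_eq_neg_of_connected_holds`);
take `o = ±o₀` (`SmoothOrientation.IsCompatible.neg`). [cite: Bredon1993, VI.7, Thm. 7.15] [cite: Hatcher2002, §3.3 p. 234] -/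
theorem SmoothOrientation.exists_isCompatible {n : ℕ} {M : Type} [TopologicalSpace M] [T2Space M]
    [ConnectedSpace M] [ChartedSpace (EuclideanSpace ℝ (Fin n)) M] [IsManifold (𝓡 n) 1 M]
    (g : HomologicalOrientation ℤ (EuclideanSpace ℝ (Fin n)) n) (μ : HomologicalOrientation ℤ M n) :
    ∃ o : SmoothOrientation (𝓡 n) M, SmoothOrientation.IsCompatible g o μ := by
  obtain ⟨o₀⟩ := nonempty_smoothOrientation_of_homologicalOrientation M g μ
  obtain ⟨μ₀, hμ₀, -⟩ := SmoothOrientation.existsUnique_isCompatible_holds (n := n) (M := M) g o₀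
  rcases HomologicalOrientation.eq_or_eq_neg_of_connected_holds M μ μ₀ with hμ | hμ
  · exact ⟨o₀, hμ ▸ hμ₀⟩
  · exact ⟨-o₀, hμ ▸ hμ₀.neg⟩

namespace NullCobordism

/-- **The orientation datum of `signatureSet` for a GIVEN oriented boundary, from a smooth
orientation of `W`.** For `M : Type` closed connected smooth of dimension `m + 1` with a smooth
orientation `o`, `c` a null-cobordism of `M` with `c.W` connected and smoothly oriented (`oW`),
whose closed model is a topological manifold, and any generator convention `g`: there are a
homological orientation `μ` of `M` compatible with `o` (`SmoothOrientation.IsCompatible g o μ`) and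
an orientation `μ'` of the closed model with `(M, μ) = bW` (`c.IsOrientedBy μ μ'`) — the clauses
of `HomotopySphere.signatureSet g m h ⟨M, o, _⟩` other than s-parallelizability and the signature
(Kervaire–Milnor 1963, §7, p. 529 and Thm. 7.5). Proof: `(μ, μ')` from `oW`
(`exists_isOrientedBy_of_smoothOrientation`); `μ = ±μ₀` for the orientation `μ₀` compatible with
`o` (Bredon VI.7.15, `SmoothOrientation.existsUnique_isCompatible_holds`; Hatcher p. 234,
`HomologicalOrientation.eq_or_eq_neg_of_connected_holds`); if `μ = -μ₀`, replace `(μ, μ')` by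
`(-μ, -μ')` — i.e. reverse the orientation of `W`, Kervaire–Milnor's `-M` (§2) — which is still an
oriented boundary datum (`IsOrientedBoundary.neg`, with `[X]_{-ν} = -[X]_ν`,
`HomologicalOrientation.fundamentalClass_neg_holds`, Hatcher p. 236). [cite: KervaireMilnorAnnals1963, §2 ("-M") and §7, p. 529, Thm. 7.5] [cite: Bredon1993, VI.7, Thm. 7.15] [cite: Hatcher2002, §3.3 pp. 234–236] -/
theorem exists_isCompatible_isOrientedBy_of_smoothOrientation {m : ℕ} {M : Type}
    [TopologicalSpace M] [T2Space M] [ConnectedSpace M]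
    [ChartedSpace (EuclideanSpace ℝ (Fin (m + 1))) M] [IsManifold (𝓡 (m + 1)) ∞ M]
    [CompactSpace M] (g : HomologicalOrientation ℤ (EuclideanSpace ℝ (Fin (m + 1))) (m + 1))
    (o : SmoothOrientation (𝓡 (m + 1)) M) (c : NullCobordism (m + 1) M) [ConnectedSpace c.W]
    [ChartedSpace (EuclideanSpace ℝ (Fin (m + 1 + 1))) (ClosedModel (m + 1) c.W)]
    (oW : SmoothOrientation (𝓡∂ (m + 1 + 1)) c.W) :
    ∃ (μ : HomologicalOrientation ℤ M (m + 1))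
      (μ' : HomologicalOrientation ℤ (ClosedModel (m + 1) c.W) (m + 1 + 1)),
      SmoothOrientation.IsCompatible g o μ ∧ c.IsOrientedBy μ μ' := by
  obtain ⟨μ, μ', h⟩ := c.exists_isOrientedBy_of_smoothOrientation oW
  obtain ⟨μ₀, hμ₀, -⟩ := SmoothOrientation.existsUnique_isCompatible_holds (n := m + 1) (M := M) g o
  rcases HomologicalOrientation.eq_or_eq_neg_of_connected_holds M μ μ₀ with hμ | hμ
  · exact ⟨μ, μ', hμ ▸ hμ₀, h⟩
  · refine ⟨-μ, -μ', ?_, ?_⟩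
    · rw [hμ, neg_neg]
      exact hμ₀
    · exact IsOrientedBoundary.neg h
        (HomologicalOrientation.fundamentalClass_neg_holds (R := ℤ) (X := M) (m + 1) μ)
        (HomologicalOrientation.fundamentalClass_neg_holds (R := ℤ)
          (X := ClosedModel (m + 1) c.W) (m + 1 + 1) μ')

end NullCobordism

end Literature.Topology.FourManifolds
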